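/-
Copyright: the b2b-balaban T⁴-continuum CRUX team, row NE7b OWNER lineage `t4-ne7b-p1` (gen 124). Project licence.
-/
import Summits.QuantumFields.BalabanUV.T4Continuum.Spine.NE7b.SupZdDataAgreement
import Summits.QuantumFields.BalabanUV.T4Continuum.Spine.NE7b.SupZdCoarseInverse
import Summits.QuantumFields.BalabanUV.T4Continuum.Spine.NE7b.SupZdPropagatorPeriodic

/-!
# THE SEAM ESTIMATE: the torus Schur-complement entry `T_k(y,y′)` (block columns `ψ^k` of `H[V∘wm_k]` on the torus of coarse period
# `3^k`) and the infinite-volume entry `T_∞(wm y, wm y′)` (block columns `Ψ` of `H_V` on `ℤ^d`) differ by at most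
# `C·e^{−δ·max(0, 3^k∕2 − 2 − ρ_k(y,0))}` — exponentially small in the depth of the ROW below the seam of the window, with `(C, δ)` from
# `(d, a, λ, Λ)` ONLY: the lift `ψ^k_{y′}∘σ` is the bounded `ℤ^d` solution with the periodised data ((185)), these data agree with
# `(V, 𝟙_{B n (wm y′)})` on the blocks of every deep coarse point `2|c i| + 4 < 3^k` (window bookkeeping, (181)), and (196)
# `zd_data_agreement` converts the agreement into `e^{−δ·dist₁(wm y, non-deep)}` (row NE7b, node U5c; (181)∕(185)∕(196) BY NAME; [folklore])

Cell `pub-balaban`, sub-cell `t4`, spine estimate NE7b (`T4WeightBudget.RelWeightBound`; the cell's OWN estimate — NOT PRINTED in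
[Bałaban 1983–89], NOT PROVED).  Crux-route work under `Spine/NE7b/` by the row OWNER (`t4-ne7b-p1` gen 124, file (197)) under FREEZE
(0)'s crux-prover clause; NOTHING of Bałaban's is named as a Lean object, valued or asserted; no `T4Continuum/Support` leaf typed; no `def`,
no notation (both entries DISPLAYED; `ψ`, `Ψ` ANY block columns with their displayed equations); zero `sorry`.  Imports (BY NAME): the
OWNER's (196) `…SupZdDataAgreement` (`zd_data_agreement`), (194) `…SupZdCoarseInverse` (`natAbs_le_l1`), (185) `…SupZdPropagatorPeriodic`
(`torus_solution_lifts`, `torus_lift_bounded`), and through them (181) `inWindow_near_of_blk`, (180) `natAbs_valMinAbs_intCast_of_lt`, the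
window kit `Beta.InfiniteVolume` (`windowMap_siteOf`, `siteOf_windowMap`, `inWindow_windowMap`, `inWindow_of_two_mul_abs_lt`), [B6]
`mem_B`, `sum_B`, `sum_B_const`.

WHY (located).  The thermodynamic limit of the next-scale Hessian — `T_k⁻¹(σ_k b, σ_k b′) → M(b,b′)` for (194)∕(195)'s `M` — goes through
[B4] (5.10) on the coarse torus `Site d (3^k)`: `A = T_k`, `A + B = T_∞∘wm`, and (5.9) asks `|B(y,y′)| ≤ c₀e^{−δ₀(ρ_k(y,y′) + ω y + ω y′)}`
with a boundary weight `ω`.  This file supplies the load-bearing third of that bound, the ROW depth `ω(y) = max(0, 3^k∕2 − 2 − ρ_k(y,0))`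
(the column depth follows by the symmetry of both operators, the `ρ_k` factor from both entry decays — assembled in the sequel): both
entries are block means over `B n (wm y)` of `ψ^k_{y′}∘σ` resp. `Ψ_{wm y′}`, two bounded `ℤ^d` solutions of the class whose data
`(V∘wm∘σ, 𝟙[σ(blk n (wm σ ·)) = y′])` and `(V, 𝟙[blk n · = wm y′])` coincide at every `p` whose block is deep (`wm(σ p) = p` by (181),
and `σ c = y′ ↔ c = wm y′` for deep `c`), while a non-deep `c` has `|wm y − c|₁ ≥ 3^k∕2 − 2 − |wm y|₁` and `|wm y|₁ = ρ_k(y,0)` (odd period).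

WHAT IS PROVED ([folklore]; coarse torus `Site d (3^k)`, fine torus `Site d ((n+1)3^k)`, `σ = siteOf`, `wm = windowMap`):
§1 `natAbs_windowMap` (`|wm y i| = |valMinAbs(y i)|`), `torusNorm_eq_l1`, `windowMap_siteOf_of_deep`, `windowMap_siteOf_of_deep_block`,
`depth_le_dist` (`c` not deep ⟹ `3^k∕2 − 2 − |b|₁ ≤ |b − c|₁`); §2 **`torus_column_lift_close`** (`∃ C δ > 0`: for ALL `n, V, Ψ, k, ψ`,
`y, y′` and `q ∈ B n (wm y)`: `|ψ_{y′}(σ q) − Ψ_{wm y′}(q)| ≤ Ce^{−δ·max(0, 3^k∕2 − 2 − ρ_k(y,0))}`), **`coarse_seam_row`** (THE END: the same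
bound for `|T_k(y,y′) − T_∞(wm y, wm y′)|`); §3 toy.

HONEST (what this is NOT).  One third of (5.9) — the symmetric∕decay assembly, (5.6) for both operators on the coarse torus, [B4] (5.10)
and the limit `T_k⁻¹ → M` are the sequel; `d ≥ 3` only; the LINEAR column only; scalar skeleton ((A3), NC-NE7b-α UNRULED); nothing of the
covariant propagators of [B4]–[B6]; nothing of Bałaban's asserted.  BY-NAME EFFECT ON THE WALL: NONE.  NE7b NOT PRINTED ∕ NOT PROVED; spine
PROVED 0∕9; rung (B)+1 — the programme's measures remain FINITE-torus statements; NOT the mass gap, NOT Clay.  HONEST DEPENDENCY: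
continuum YM on T⁴ ⇐ BetaPertH ∧ nine spine estimates (0∕9 proved); BetaPertH ⇐ (D1) ∧ (D4) ∧ CAP+tail; G-an2-4 gates asym, D1 and NE2∕3∕4.
-/

set_option autoImplicit false

noncomputable section

namespace Summit.QuantumFields.BalabanUV.T4Continuum.NE7b.SupZdCoarseTorusSeam

open Real Filter Topology
open Literature.MathematicalPhysics.QuantumFieldTheory.Balaban1983to89
open B6QGQLower276 (X e blk B side chart mem_B sum_B sum_B_const card_cube blk_chart)
open Beta (Site siteOf windowMap siteOf_windowMap windowMap_siteOf inWindow_windowMap inWindow_of_two_mul_abs_lt InWindow)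
open SupZdPropagatorLimit (natAbs_valMinAbs_intCast_of_lt)
open SupZdPropagatorUniqueness (inWindow_near_of_blk)
open SupZdPropagatorPeriodic (torus_solution_lifts torus_lift_bounded)
open SupZdCoarseInverse (natAbs_le_l1)
open SupZdDataAgreement (zd_data_agreement)

variable {d : ℕ}

/-! ## §1. Window bookkeeping: the window representative has the torus norm; deep blocks lie in both windows; the seam depth -/

/-- The window representative of a coarse torus site has `|wm y i| = |valMinAbs (y i)|` (odd period `3^k`: the window is symmetric). [folklore] -/
theorem natAbs_windowMap (k : ℕ) (y : Site d (3 ^ k)) (i : Fin d) :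
    (windowMap d (3 ^ k) y i).natAbs = ((y i).valMinAbs).natAbs := by
  have hodd : Odd (3 ^ k) := Odd.pow (by decide)
  obtain ⟨m, hm⟩ := hodd
  have hm' : ((3 ^ k : ℕ) : ℤ) = 2 * (m : ℤ) + 1 := by rw [hm]; push_cast; ring
  obtain ⟨h1, h2⟩ := inWindow_windowMap y i
  have hlt : 2 * (windowMap d (3 ^ k) y i).natAbs < 3 ^ k := by
    have : 2 * (((windowMap d (3 ^ k) y i).natAbs : ℕ) : ℤ) < ((3 ^ k : ℕ) : ℤ) := by
      rw [Int.natCast_natAbs]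
      rcases abs_cases (windowMap d (3 ^ k) y i) with ⟨h, _⟩ | ⟨h, _⟩ <;> omega
    omega
  have h := natAbs_valMinAbs_intCast_of_lt (3 ^ k) (windowMap d (3 ^ k) y i) hlt
  have hrep : (((windowMap d (3 ^ k) y i : ℤ)) : ZMod (3 ^ k)) = y i := congrFun (siteOf_windowMap d (3 ^ k) y) i
  rw [hrep] at h
  exact h.symm

/-- **THE TORUS NORM IS THE `ℓ¹` NORM OF THE WINDOW REPRESENTATIVE**: `Σ_i|valMinAbs(y i)| = |wm y|₁`. [folklore] -/
theorem torusNorm_eq_l1 (k : ℕ) (y : Site d (3 ^ k)) :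
    ∑ i, ((((y i).valMinAbs).natAbs : ℕ) : ℝ) = ∑ i, (((windowMap d (3 ^ k) y i).natAbs : ℕ) : ℝ) :=
  Finset.sum_congr rfl fun i _ => by rw [natAbs_windowMap]

/-- **DEEP COARSE POINTS ARE WINDOW POINTS**: `2|c i| + 4 < 3^k` for all `i` ⟹ `wm(σ c) = c` on the coarse torus. [folklore] -/
theorem windowMap_siteOf_of_deep (k : ℕ) (c : X d) (hc : ∀ i, 2 * |c i| + 4 < ((3 ^ k : ℕ) : ℤ)) :
    windowMap d (3 ^ k) (siteOf d (3 ^ k) c) = c :=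
  windowMap_siteOf d (3 ^ k) fun i => inWindow_of_two_mul_abs_lt (by have := hc i; omega)

/-- **THE BLOCKS OF DEEP COARSE POINTS ARE FINE WINDOW POINTS**: `2|blk n p i| + 4 < 3^k` for all `i` ⟹ `wm(σ p) = p` on the fine torus.
[folklore] -/
theorem windowMap_siteOf_of_deep_block (n k : ℕ) (p : X d) (hp : ∀ i, 2 * |blk n p i| + 4 < ((3 ^ k : ℕ) : ℤ)) :
    windowMap d ((n + 1) * 3 ^ k) (siteOf d ((n + 1) * 3 ^ k) p) = p :=
  windowMap_siteOf d ((n + 1) * 3 ^ k) ((inWindow_near_of_blk n (3 ^ k) p hp).1 p rfl)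

/-- **THE SEAM DEPTH**: a coarse point `c` that is NOT deep (`¬∀ i, 2|c i| + 4 < 3^k`) is at `ℓ¹` distance `≥ 3^k∕2 − 2 − |b|₁` from every
`b`. [folklore] -/
theorem depth_le_dist (k : ℕ) (b c : X d) (hc : ¬ ∀ i, 2 * |c i| + 4 < ((3 ^ k : ℕ) : ℤ)) :
    ((3 ^ k : ℕ) : ℝ) / 2 - 2 - ∑ j, (((b j).natAbs : ℕ) : ℝ) ≤ ∑ j, (((b j - c j).natAbs : ℕ) : ℝ) := by
  push Not at hc
  obtain ⟨i, hi⟩ := hc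
  -- `3^k ≤ 2|c i| + 4 ≤ 2(|b i| + |b i − c i|) + 4 ≤ 2(|b|₁ + |b − c|₁) + 4`
  have h1 : (c i).natAbs ≤ (b i).natAbs + (b i - c i).natAbs := by
    have := Int.natAbs_add_le (b i) (-(b i - c i))
    rwa [show b i + -(b i - c i) = c i by ring, Int.natAbs_neg] at this
  have h2 := natAbs_le_l1 b i
  have h3 : (b i - c i).natAbs ≤ ∑ j, (b j - c j).natAbs :=
    Finset.single_le_sum (f := fun j => (b j - c j).natAbs) (fun _ _ => Nat.zero_le _) (Finset.mem_univ i)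
  have h4 : (3 ^ k : ℕ) ≤ 2 * (∑ j, (b j).natAbs) + 2 * (∑ j, (b j - c j).natAbs) + 4 := by
    have e : |c i| = ((c i).natAbs : ℤ) := (Int.natCast_natAbs (c i)).symm
    rw [e] at hi
    omega
  have h5 : ((3 ^ k : ℕ) : ℝ) ≤ 2 * ∑ j, (((b j).natAbs : ℕ) : ℝ) + 2 * ∑ j, (((b j - c j).natAbs : ℕ) : ℝ) + 4 := by
    exact_mod_cast h4
  linarith

/-! ## §2. The seam estimate for one row: the torus entry and the infinite-volume entry differ by `C·e^{−δ·depth}` -/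

/-- **THE LIFTED TORUS BLOCK COLUMN AND THE `ℤ^d` BLOCK COLUMN AGREE AWAY FROM THE SEAM**: `∃ C δ > 0` from `(d, a, λ, Λ)` such that for
ALL `n`, `V : ℤ^d → [−λ, Λ]`, ANY bounded `ℤ^d` block columns `Ψ`, every level `k`, ANY torus block columns `ψ` of `H[V∘wm_k]`, and all
coarse torus sites `y, y′`: at every `q` of the block of `wm y`, `|ψ_{y′}(σ q) − Ψ_{wm y′}(q)| ≤ C·e^{−δ·max(0, 3^k∕2 − 2 − |wm y|₁)}` — the
lift `ψ_{y′}∘σ` is a bounded `ℤ^d` solution with the periodised data ((185)), which agree with `(V, 𝟙_{B n (wm y′)})` on the blocks of the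
deep coarse points (§1), so (196) `zd_data_agreement` applies with the seam depth. [folklore] -/
theorem torus_column_lift_close (hd : 3 ≤ d) (a : ℝ) (ha : 0 < a) {lam Lam : ℝ} (hlam : lam < min 2 a) (hLam : 0 ≤ Lam) :
    ∃ C δ : ℝ, 0 < C ∧ 0 < δ ∧ ∀ (n : ℕ) (V : X d → ℝ), (∀ p, -lam ≤ V p) → (∀ p, V p ≤ Lam) →
      ∀ (Ψ : X d → X d → ℝ) (BΨ : X d → ℝ), (∀ b' p, |Ψ b' p| ≤ BΨ b') →
      (∀ b' p, ((n : ℝ) + 1) ^ 2 * ∑ μ, (2 * Ψ b' p - Ψ b' (p + e μ) - Ψ b' (p - e μ))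
        + a / ((n : ℝ) + 1) ^ d * ∑ q ∈ B n (blk n p), Ψ b' q + V p * Ψ b' p = if blk n p = b' then 1 else 0) →
      ∀ (k : ℕ) (ψ : Site d (3 ^ k) → Site d ((n + 1) * 3 ^ k) → ℝ),
      (∀ (y' : Site d (3 ^ k)) (x : Site d ((n + 1) * 3 ^ k)),
        ((n : ℝ) + 1) ^ 2 * ∑ μ, (2 * ψ y' x - ψ y' (x + siteOf d ((n + 1) * 3 ^ k) (e μ)) - ψ y' (x - siteOf d ((n + 1) * 3 ^ k) (e μ)))
          + a / ((n : ℝ) + 1) ^ d * ∑ q ∈ B n (blk n (windowMap d ((n + 1) * 3 ^ k) x)), ψ y' (siteOf d ((n + 1) * 3 ^ k) q)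
          + V (windowMap d ((n + 1) * 3 ^ k) x) * ψ y' x
          = if siteOf d (3 ^ k) (blk n (windowMap d ((n + 1) * 3 ^ k) x)) = y' then 1 else 0) →
      ∀ (y y' : Site d (3 ^ k)) (q : X d), q ∈ B n (windowMap d (3 ^ k) y) →
        |ψ y' (siteOf d ((n + 1) * 3 ^ k) q) - Ψ (windowMap d (3 ^ k) y') q|
          ≤ C * exp (-(δ * max 0 (((3 ^ k : ℕ) : ℝ) / 2 - 2 - ∑ i, ((((y i).valMinAbs).natAbs : ℕ) : ℝ)))) := by
  classical
  obtain ⟨C, δ, hC, hδ, H196⟩ := zd_data_agreement (d := d) hd a ha hlam hLam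
  refine ⟨C * 1, δ, by positivity, hδ, ?_⟩
  intro n V hV hV' Ψ BΨ hΨB hΨ k ψ hψ y y' q hq
  -- the lift of the torus column: a bounded `ℤ^d` solution with the periodised data ((185))
  have hlift := torus_solution_lifts n a (3 ^ k) (fun x => V (windowMap d ((n + 1) * 3 ^ k) x)) (ψ y')
    (fun x => if siteOf d (3 ^ k) (blk n (windowMap d ((n + 1) * 3 ^ k) x)) = y' then (1 : ℝ) else 0) (hψ y')
  obtain ⟨B₁, hB₁⟩ := torus_lift_bounded (d := d) ((n + 1) * 3 ^ k) (ψ y')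
  -- the two data sets agree on the blocks of the deep coarse points
  have hagree : ∀ p : X d, blk n p ∈ {c : X d | ∀ i, 2 * |c i| + 4 < ((3 ^ k : ℕ) : ℤ)} →
      (fun p => V (windowMap d ((n + 1) * 3 ^ k) (siteOf d ((n + 1) * 3 ^ k) p))) p = V p ∧
      (fun p => if siteOf d (3 ^ k) (blk n (windowMap d ((n + 1) * 3 ^ k) (siteOf d ((n + 1) * 3 ^ k) p))) = y' then (1 : ℝ) else 0) p
        = (fun p => if blk n p = windowMap d (3 ^ k) y' then (1 : ℝ) else 0) p := by
    intro p hp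
    simp only [Set.mem_setOf_eq] at hp
    have hwin := windowMap_siteOf_of_deep_block n k p hp
    refine ⟨by simp only [hwin], ?_⟩
    simp only [hwin]
    have hiff : siteOf d (3 ^ k) (blk n p) = y' ↔ blk n p = windowMap d (3 ^ k) y' := by
      constructor
      · intro h
        rw [← windowMap_siteOf_of_deep k (blk n p) hp, h]
      · intro h
        rw [h, siteOf_windowMap]
    by_cases h : blk n p = windowMap d (3 ^ k) y'
    · rw [if_pos (hiff.2 h), if_pos h]
    · rw [if_neg (fun h' => h (hiff.1 h')), if_neg h]
  -- (196) with `M = 1` and the seam depth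
  have h := H196 n (fun p => V (windowMap d ((n + 1) * 3 ^ k) (siteOf d ((n + 1) * 3 ^ k) p))) V (fun p => hV _) (fun p => hV' _) hV hV'
    (fun p => if siteOf d (3 ^ k) (blk n (windowMap d ((n + 1) * 3 ^ k) (siteOf d ((n + 1) * 3 ^ k) p))) = y' then (1 : ℝ) else 0)
    (fun p => if blk n p = windowMap d (3 ^ k) y' then (1 : ℝ) else 0) 1
    (fun p => by split_ifs <;> simp) (fun p => by split_ifs <;> simp)
    (fun p => ψ y' (siteOf d ((n + 1) * 3 ^ k) p)) (Ψ (windowMap d (3 ^ k) y')) B₁ (BΨ (windowMap d (3 ^ k) y')) hB₁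
    (hΨB (windowMap d (3 ^ k) y')) hlift (hΨ (windowMap d (3 ^ k) y'))
    {c : X d | ∀ i, 2 * |c i| + 4 < ((3 ^ k : ℕ) : ℤ)} hagree q
    (max 0 (((3 ^ k : ℕ) : ℝ) / 2 - 2 - ∑ i, ((((y i).valMinAbs).natAbs : ℕ) : ℝ))) (fun c hc => ?_)
  · simpa only [mul_one] using h
  · -- the seam depth is below the distance from the block `wm y = blk n q` to every non-deep coarse point
    simp only [Set.mem_setOf_eq] at hc
    rw [mem_B.1 hq, torusNorm_eq_l1 k y]
    exact max_le (by positivity) (depth_le_dist k (windowMap d (3 ^ k) y) c hc)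

/-- **THE SEAM ESTIMATE FOR ONE ROW OF THE COARSE OPERATORS**: with the data of `torus_column_lift_close`,
`|T_k(y,y′) − T_∞(wm y, wm y′)| ≤ C·e^{−δ·max(0, 3^k∕2 − 2 − |wm y|₁)}` — both entries are block means over the block of `wm y`
(`sum_B`), of functions that are close there. [folklore] -/
theorem coarse_seam_row (hd : 3 ≤ d) (a : ℝ) (ha : 0 < a) {lam Lam : ℝ} (hlam : lam < min 2 a) (hLam : 0 ≤ Lam) :
    ∃ C δ : ℝ, 0 < C ∧ 0 < δ ∧ ∀ (n : ℕ) (V : X d → ℝ), (∀ p, -lam ≤ V p) → (∀ p, V p ≤ Lam) →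
      ∀ (Ψ : X d → X d → ℝ) (BΨ : X d → ℝ), (∀ b' p, |Ψ b' p| ≤ BΨ b') →
      (∀ b' p, ((n : ℝ) + 1) ^ 2 * ∑ μ, (2 * Ψ b' p - Ψ b' (p + e μ) - Ψ b' (p - e μ))
        + a / ((n : ℝ) + 1) ^ d * ∑ q ∈ B n (blk n p), Ψ b' q + V p * Ψ b' p = if blk n p = b' then 1 else 0) →
      ∀ (k : ℕ) (ψ : Site d (3 ^ k) → Site d ((n + 1) * 3 ^ k) → ℝ),
      (∀ (y' : Site d (3 ^ k)) (x : Site d ((n + 1) * 3 ^ k)),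
        ((n : ℝ) + 1) ^ 2 * ∑ μ, (2 * ψ y' x - ψ y' (x + siteOf d ((n + 1) * 3 ^ k) (e μ)) - ψ y' (x - siteOf d ((n + 1) * 3 ^ k) (e μ)))
          + a / ((n : ℝ) + 1) ^ d * ∑ q ∈ B n (blk n (windowMap d ((n + 1) * 3 ^ k) x)), ψ y' (siteOf d ((n + 1) * 3 ^ k) q)
          + V (windowMap d ((n + 1) * 3 ^ k) x) * ψ y' x
          = if siteOf d (3 ^ k) (blk n (windowMap d ((n + 1) * 3 ^ k) x)) = y' then 1 else 0) →
      ∀ y y' : Site d (3 ^ k),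
        |(((n : ℝ) + 1) ^ d)⁻¹ * ∑ z : Fin d → Fin (n + 1), ψ y' (siteOf d ((n + 1) * 3 ^ k) (chart n (windowMap d (3 ^ k) y) z))
          - (((n : ℝ) + 1) ^ d)⁻¹ * ∑ q ∈ B n (windowMap d (3 ^ k) y), Ψ (windowMap d (3 ^ k) y') q|
          ≤ C * exp (-(δ * max 0 (((3 ^ k : ℕ) : ℝ) / 2 - 2 - ∑ i, ((((y i).valMinAbs).natAbs : ℕ) : ℝ)))) := by
  classical
  obtain ⟨C, δ, hC, hδ, H⟩ := torus_column_lift_close (d := d) hd a ha hlam hLam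
  refine ⟨C, δ, hC, hδ, ?_⟩
  intro n V hV hV' Ψ BΨ hΨB hΨ k ψ hψ y y'
  have hvol : (0 : ℝ) < ((n : ℝ) + 1) ^ d := by positivity
  rw [← sum_B (windowMap d (3 ^ k) y) (fun q => ψ y' (siteOf d ((n + 1) * 3 ^ k) q)), ← mul_sub, ← Finset.sum_sub_distrib,
    abs_mul, abs_inv, abs_of_pos hvol, inv_mul_le_iff₀ hvol]
  calc |∑ q ∈ B n (windowMap d (3 ^ k) y), (ψ y' (siteOf d ((n + 1) * 3 ^ k) q) - Ψ (windowMap d (3 ^ k) y') q)|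
      ≤ ∑ q ∈ B n (windowMap d (3 ^ k) y), |ψ y' (siteOf d ((n + 1) * 3 ^ k) q) - Ψ (windowMap d (3 ^ k) y') q| :=
        Finset.abs_sum_le_sum_abs _ _
    _ ≤ ∑ _q ∈ B n (windowMap d (3 ^ k) y), C * exp (-(δ * max 0 (((3 ^ k : ℕ) : ℝ) / 2 - 2 - ∑ i, ((((y i).valMinAbs).natAbs : ℕ) : ℝ)))) :=
        Finset.sum_le_sum fun q hq => H n V hV hV' Ψ BΨ hΨB hΨ k ψ hψ y y' q hq
    _ = ((n : ℝ) + 1) ^ d * (C * exp (-(δ * max 0 (((3 ^ k : ℕ) : ℝ) / 2 - 2 - ∑ i, ((((y i).valMinAbs).natAbs : ℕ) : ℝ))))) :=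
        sum_B_const _ _

/-! ## §3. Toy -/

/-- Toy (`d = 2`, `k = 1`): the origin of the coarse torus `(ℤ∕3)²` has window representative of `ℓ¹` norm `0 = ρ₁(0,0)`. -/
example : ∑ i, (((((0 : Site 2 (3 ^ 1)) i).valMinAbs).natAbs : ℕ) : ℝ) = ∑ i, (((windowMap 2 (3 ^ 1) 0 i).natAbs : ℕ) : ℝ) :=
  torusNorm_eq_l1 (d := 2) 1 0

end Summit.QuantumFields.BalabanUV.T4Continuum.NE7b.SupZdCoarseTorusSeam
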